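import Summits.ResolutionOfSingularities.KangarooAtlas.MizutaniHironakaDimension
import HarnessLib

/-!
# Mizutani's conjecture — "`dim B_{P,𝔭} ≤ 2p − 2` ⇒ `B_{P,𝔭}` is a vector group" in Hironaka's vocabulary

Cell topic `Summits/ResolutionOfSingularities/KangarooAtlas` (pub-rosobs); namespace
`Summit.ResolutionOfSingularities.KangarooAtlas.Mizutani`.  AI-written; *AI review is weaker than expert review*; NOT a
resolution theorem, NOT summit progress.  The typing file `Literature/…/HironakaGroupSchemeMultiplicity.lean` (cell
res-hironaka) records Mizutani's printed theorem "(1) if `dim B_{Pⁿ,p} ≤ 2p − 2` then it is a vector group" (Nagoya Math. J.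
52 (1973) p. 85 (1), Thm. 2.8) as the NAMED FACT `HironakaScheme.Mizutani1973_vectorGroup_of_dim_le p`, in Hironaka's
multiplicity vocabulary (`bIdeal k 𝔭 = U_+(𝔭)S`, `IsVectorGroup k 𝔭`: that ideal is generated by its linear forms).  The
Mizutani chain of this directory proves the same theorem — indeed `m(e) = 2p^e − 1` for all `e` — in Oda's coefficient
vocabulary (`mizutaniLowerBound`, `mizutani1973_m_one`).  This file transports it: for a point `𝔭` of `ℙ^n_k`,

* `isVectorGroup_of_exponentLE_zero` — if `exponent B(𝔭) = 0` (Oda: `(L_B)_j = k·F^j (L_B)_0`) then `U_+(𝔭)S` is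
  generated by its linear forms;
* `exponent_eq_zero_of_ringKrullDim_bIdeal_le` — if `dim B_{P,𝔭} + 2 ≤ 2p` then `exponent B(𝔭) = 0` (Mizutani's lower
  bound `2p^{exponent} ≤ dim + 1`);
* **`isVectorGroup_of_ringKrullDim_bIdeal_le`**, and the named fact itself **`mizutani1973_vectorGroup_of_dim_le_of`**,

all conditional on the two cited theorems that identify the vocabularies: Hironaka's "`U(𝔭)` is generated by additive
forms" (`Hironaka1970_thm1_cor`) and Oda's `U(𝔭) ∩ L_e = (L_B)_e` (Oda 1973 Prop. 2.2 (ii); displayed hypothesis `hOda`,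
its `⊆` half being the tree's `hirForms_le_invForms`).

References: [Mizutani1973HironakaGroupSchemes] p. 85 (1), Rem. 1.2, Thm. 2.8, Remark 2.10; [Oda1983HironakaGroupSchemeII] §2 (p. 1168).
-/

open MvPolynomial Literature.AlgebraicGeometry.Resolution Literature.AlgebraicGeometry.Resolution.HironakaScheme

namespace Summit.ResolutionOfSingularities.KangarooAtlas.Mizutani

universe u

section VectorGroup

variable (k : Type u) [Field k] (p : ℕ) [hp : Fact p.Prime] [CharP k p] {n : ℕ}
  (𝔭 : Ideal (MvPolynomial (Fin (n + 1)) k))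

/-- **`exponent B(𝔭) = 0` ⇒ `B_{P,𝔭}` is a vector group** (Mizutani Rem. 1.2: "B is a vector group iff the exponent of B
equals 0"), here: `U_+(𝔭)S` is generated by its linear forms — every invariant additive form of level `j` is a
`k`-combination of `p^j`-th powers of invariant LINEAR forms.  Conditional on `Hironaka1970_thm1_cor` and Oda's equality.
[cite: Mizutani1973HironakaGroupSchemes, Rem. 1.2 (p. 86)] -/
theorem isVectorGroup_of_exponentLE_zero [𝔭.IsPrime] (hH : Hironaka1970_thm1_cor.{u} p)
    (hOda : ∀ e, hirForms k p 𝔭 e = invForms k p 𝔭 e) (hP : IsPoint k 𝔭) (h0 : ExponentLE k p 𝔭 0) :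
    IsVectorGroup k 𝔭 := by
  have hfun : hirForms k p 𝔭 = invForms k p 𝔭 := funext hOda
  have hB : bIdeal k 𝔭 = famIdeal k p (invForms k p 𝔭) := by
    rw [bIdeal_eq_famIdeal_hirForms k p 𝔭 hH hP, hfun]
  unfold IsVectorGroup
  refine le_antisymm ?_ (span_inter_one_le 𝔭)
  -- every generator `addForm j a`, `a ∈ (L_B)_j = k·F^j (L_B)_0`, lies in the ideal of the linear forms of `B`
  set T : Ideal (MvPolynomial (Fin (n + 1)) k) := Ideal.span ((bIdeal k 𝔭 : Set (MvPolynomial (Fin (n + 1)) k)) ∩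
    (homogeneousSubmodule (Fin (n + 1)) k 1 : Set (MvPolynomial (Fin (n + 1)) k))) with hT
  have hlin : ∀ b ∈ invForms k p 𝔭 0, addForm k p 0 b ∈ T := by
    intro b hb
    refine Ideal.subset_span ⟨?_, ?_⟩
    · rw [SetLike.mem_coe, hB]
      exact levelIdeal_le_famIdeal k p (invForms k p 𝔭) 0 (Ideal.subset_span ⟨b, hb, rfl⟩)
    · rw [SetLike.mem_coe, mem_homogeneousSubmodule]
      have h := isHomogeneous_addForm k p 0 b
      rwa [pow_zero] at h
  conv_lhs => rw [hB]
  unfold famIdeal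
  rw [Ideal.span_le]
  rintro _ ⟨_, ⟨j, rfl⟩, ⟨a, ha, rfl⟩⟩
  rw [SetLike.mem_coe]
  have ha' : a ∈ Submodule.span k (frobVec k p j '' (invForms k p 𝔭 0 : Set (Fin (n + 1) → k))) := by
    have := h0 j (Nat.zero_le j)
    rw [Nat.sub_zero] at this
    rw [← this]; exact ha
  have hmem : addForm k p j a ∈
      Ideal.span (addFormLin k p j '' (frobVec k p j '' (invForms k p 𝔭 0 : Set (Fin (n + 1) → k)))) := by
    rw [← ideal_span_image_span, ← addFormLin_apply]
    exact Ideal.subset_span ⟨a, ha', rfl⟩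
  refine (Ideal.span_le.mpr ?_) hmem
  rintro _ ⟨_, ⟨b, hb, rfl⟩, rfl⟩
  have hpow : addForm k p j (frobVec k p j b) = addForm k p 0 b ^ p ^ j := by
    rw [addForm_pow_pow, Nat.zero_add]
  rw [SetLike.mem_coe, addFormLin_apply, hpow]
  exact Ideal.pow_mem_of_mem _ (hlin b hb) _ (pow_pos hp.out.pos _)

/-- **`dim B_{P,𝔭} + 2 ≤ 2p` ⇒ `exponent B(𝔭) = 0`**: by Mizutani's lower bound `2·p^{exponent} ≤ dim B + 1`
(`two_mul_pow_exponent_le_ringKrullDim_bIdeal_succ`).  Conditional on `Hironaka1970_thm1_cor` and Oda's equality.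
[cite: Mizutani1973HironakaGroupSchemes, p. 85 (1) and Thm. 2.8] -/
theorem exponent_eq_zero_of_ringKrullDim_bIdeal_le [𝔭.IsPrime] (hH : Hironaka1970_thm1_cor.{u} p)
    (hOda : ∀ e, hirForms k p 𝔭 e = invForms k p 𝔭 e) (hP : IsPoint k 𝔭)
    (hdim : ringKrullDim (MvPolynomial (Fin (n + 1)) k ⧸ bIdeal k 𝔭) + 2 ≤ (2 * p : WithBot ℕ∞)) :
    exponent k p 𝔭 = 0 := by
  rw [ringKrullDim_quotient_bIdeal_eq_hsDim k p 𝔭 hH hOda hP] at hdim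
  have hdim' : hsDim k p 𝔭 + 2 ≤ 2 * p := by
    have : ((hsDim k p 𝔭 + 2 : ℕ) : WithBot ℕ∞) ≤ ((2 * p : ℕ) : WithBot ℕ∞) := by simpa using hdim
    exact_mod_cast this
  have hlb := two_mul_pow_exponent_le k p 𝔭 hP
  by_contra hne
  have hpe : p ≤ p ^ exponent k p 𝔭 := by
    calc p = p ^ 1 := (pow_one p).symm
      _ ≤ p ^ exponent k p 𝔭 := Nat.pow_le_pow_right hp.out.pos (Nat.one_le_iff_ne_zero.mpr hne)
  omega

/-- **MIZUTANI'S THEOREM "(1)" in Hironaka's vocabulary**: for a point `𝔭` of `ℙ^n_k` with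
`dim B_{P,𝔭} = ringKrullDim (S ⧸ U_+(𝔭)S) ≤ 2p − 2`, the Hironaka scheme is a vector group (`U_+(𝔭)S` is generated by
linear forms) — from the tree's `mizutaniLowerBound`, conditional on `Hironaka1970_thm1_cor` and Oda's equality
`U(𝔭) ∩ L_e = (L_B)_e`. [cite: Mizutani1973HironakaGroupSchemes, p. 85 (1) (proved as Thm. 2.8)] -/
theorem isVectorGroup_of_ringKrullDim_bIdeal_le [𝔭.IsPrime] (hH : Hironaka1970_thm1_cor.{u} p)
    (hOda : ∀ e, hirForms k p 𝔭 e = invForms k p 𝔭 e) (hP : IsPoint k 𝔭)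
    (hdim : ringKrullDim (MvPolynomial (Fin (n + 1)) k ⧸ bIdeal k 𝔭) + 2 ≤ (2 * p : WithBot ℕ∞)) :
    IsVectorGroup k 𝔭 :=
  isVectorGroup_of_exponentLE_zero k p 𝔭 hH hOda hP
    ((exponent_le_iff k p 𝔭).mp (exponent_eq_zero_of_ringKrullDim_bIdeal_le k p 𝔭 hH hOda hP hdim).le)

end VectorGroup

/-- **The named fact `Mizutani1973_vectorGroup_of_dim_le` of `HironakaGroupSchemeMultiplicity.lean`, DISCHARGED MODULO
the two vocabulary-identifying theorems**: Hironaka's "`U(𝔭)` is generated by additive forms" (`Hironaka1970_thm1_cor`) and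
Oda's `U(𝔭) ∩ L_e = (L_B)_e` at every prime of every `k[X_0, …, X_n]` (Oda 1973 Prop. 2.2 (ii), hypothesis `hOda`).  The
mathematics is the tree's `mizutaniLowerBound` (`m(1) ≥ 2p − 1`). [cite: Mizutani1973HironakaGroupSchemes, p. 85 (1), Thm. 2.8] -/
theorem mizutani1973_vectorGroup_of_dim_le_of (p : ℕ) [Fact p.Prime] (hH : Hironaka1970_thm1_cor.{u} p)
    (hOda : ∀ (k : Type u) [Field k] [CharP k p] (n : ℕ) (𝔭 : Ideal (MvPolynomial (Fin (n + 1)) k)) [𝔭.IsPrime]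
      (e : ℕ), hirForms k p 𝔭 e = invForms k p 𝔭 e) :
    Mizutani1973_vectorGroup_of_dim_le.{u} p := by
  intro k _ _ n 𝔭 hP hdim
  haveI : 𝔭.IsPrime := hP.1
  exact isVectorGroup_of_ringKrullDim_bIdeal_le k p 𝔭 hH (hOda k n 𝔭) hP hdim

/-! ## Without Oda's equality: Hironaka's generation theorem alone suffices

(Appended by encloser-2 g4.)  At a point whose scheme is a vector group in Oda's sense, Oda's equality `U(𝔭) ∩ L_e = (L_B)_e`
HOLDS in the tree (`hirForms_eq_invForms_of_exponentLE_zero`, encloser-1 g3), and `U(𝔭) ∩ L_e ⊆ (L_B)_e` always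
(`hirForms_le_invForms`) gives `hsDim ≤ dim B_{P,𝔭}`; so the named fact "`dim B_{P,𝔭} ≤ 2p − 2` ⇒ vector group" needs
only Hironaka's generation theorem `Hironaka1970_thm1_cor`. -/

section HironakaOnly

variable (k : Type u) [Field k] (p : ℕ) [hp : Fact p.Prime] [CharP k p] {n : ℕ}
  (𝔭 : Ideal (MvPolynomial (Fin (n + 1)) k))

/-- `exponent B(𝔭) = 0` ⇒ `B_{P,𝔭}` is a vector group, conditional on `Hironaka1970_thm1_cor` ONLY (Oda's equality holds at
such points: `hirForms_eq_invForms_of_exponentLE_zero`). [cite: Mizutani1973HironakaGroupSchemes, Rem. 1.2 (p. 86)] -/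
theorem isVectorGroup_of_exponentLE_zero' [𝔭.IsPrime] (hH : Hironaka1970_thm1_cor.{u} p) (hP : IsPoint k 𝔭)
    (h0 : ExponentLE k p 𝔭 0) : IsVectorGroup k 𝔭 :=
  isVectorGroup_of_exponentLE_zero k p 𝔭 hH (fun e => hirForms_eq_invForms_of_exponentLE_zero h0 e) hP h0

/-- **`hsDim 𝔭 ≤ dim B_{P,𝔭}`** (Oda's dimension is at most Hironaka's), conditional on `Hironaka1970_thm1_cor` only: both are
`(n+1) −` an eventual dimension, and `U(𝔭) ∩ L_e ⊆ (L_B)_e` (`hirForms_le_invForms`).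
[cite: Mizutani1973HironakaGroupSchemes, Thm. 1.3; Oda1983HironakaGroupSchemeII, §2 (p. 1168)] -/
theorem hsDim_le_ringKrullDim_bIdeal [𝔭.IsPrime] (hH : Hironaka1970_thm1_cor.{u} p) (hP : IsPoint k 𝔭) :
    (hsDim k p 𝔭 : WithBot ℕ∞) ≤ ringKrullDim (MvPolynomial (Fin (n + 1)) k ⧸ bIdeal k 𝔭) := by
  obtain ⟨e₁, he₁⟩ := exists_eventually_eq_span_hirForms k p 𝔭
  rw [ringKrullDim_quotient_bIdeal k p 𝔭 hH hP (e₀ := e₁) (fun j hj => (he₁ j hj).le)]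
  -- compare at the level `e* = e₁ + exponent`
  set eS := e₁ + exponent k p 𝔭 with heS
  have hhir : Module.finrank k (hirForms k p 𝔭 eS) = Module.finrank k (hirForms k p 𝔭 e₁) := by
    rw [he₁ eS (Nat.le_add_right _ _), finrank_span_frobVec_image]
  have hle : Module.finrank k (hirForms k p 𝔭 eS) ≤ Module.finrank k (invForms k p 𝔭 eS) :=
    Submodule.finrank_mono (hirForms_le_invForms 𝔭 eS)
  have hdim : hsDim k p 𝔭 = hsDimAt k p 𝔭 eS :=
    (hsDimAt_eq_hsDim k p 𝔭 ((exponent_le_iff k p 𝔭).mp (Nat.le_add_left _ _))).symm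
  have hnat : hsDim k p 𝔭 ≤ n + 1 - Module.finrank k (hirForms k p 𝔭 e₁) := by
    rw [hdim, ← hhir]
    unfold hsDimAt
    omega
  exact_mod_cast hnat

/-- **`dim B_{P,𝔭} + 2 ≤ 2p` ⇒ `exponent B(𝔭) = 0`**, conditional on `Hironaka1970_thm1_cor` only.
[cite: Mizutani1973HironakaGroupSchemes, p. 85 (1) and Thm. 2.8] -/
theorem exponent_eq_zero_of_ringKrullDim_bIdeal_le' [𝔭.IsPrime] (hH : Hironaka1970_thm1_cor.{u} p) (hP : IsPoint k 𝔭)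
    (hdim : ringKrullDim (MvPolynomial (Fin (n + 1)) k ⧸ bIdeal k 𝔭) + 2 ≤ (2 * p : WithBot ℕ∞)) :
    exponent k p 𝔭 = 0 := by
  obtain ⟨e₁, he₁⟩ := exists_eventually_eq_span_hirForms k p 𝔭
  have hB := ringKrullDim_quotient_bIdeal k p 𝔭 hH hP (e₀ := e₁) (fun j hj => (he₁ j hj).le)
  have hle := hsDim_le_ringKrullDim_bIdeal k p 𝔭 hH hP
  rw [hB] at hdim hle
  have hle' : hsDim k p 𝔭 ≤ n + 1 - Module.finrank k (hirForms k p 𝔭 e₁) := by exact_mod_cast hle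
  have hdim' : (n + 1 - Module.finrank k (hirForms k p 𝔭 e₁)) + 2 ≤ 2 * p := by
    have : ((n + 1 - Module.finrank k (hirForms k p 𝔭 e₁) + 2 : ℕ) : WithBot ℕ∞) ≤ ((2 * p : ℕ) : WithBot ℕ∞) := by
      simpa using hdim
    exact_mod_cast this
  have hlb := two_mul_pow_exponent_le k p 𝔭 hP
  by_contra hne
  have hpe : p ≤ p ^ exponent k p 𝔭 := by
    calc p = p ^ 1 := (pow_one p).symm
      _ ≤ p ^ exponent k p 𝔭 := Nat.pow_le_pow_right hp.out.pos (Nat.one_le_iff_ne_zero.mpr hne)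
  omega

/-- **Mizutani's "(1)" in Hironaka's vocabulary, conditional on `Hironaka1970_thm1_cor` ONLY**: a point with
`dim B_{P,𝔭} ≤ 2p − 2` has a vector group as Hironaka scheme. [cite: Mizutani1973HironakaGroupSchemes, p. 85 (1) (proved as Thm. 2.8)] -/
theorem isVectorGroup_of_ringKrullDim_bIdeal_le' [𝔭.IsPrime] (hH : Hironaka1970_thm1_cor.{u} p) (hP : IsPoint k 𝔭)
    (hdim : ringKrullDim (MvPolynomial (Fin (n + 1)) k ⧸ bIdeal k 𝔭) + 2 ≤ (2 * p : WithBot ℕ∞)) :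
    IsVectorGroup k 𝔭 :=
  isVectorGroup_of_exponentLE_zero' k p 𝔭 hH hP
    ((exponent_le_iff k p 𝔭).mp (exponent_eq_zero_of_ringKrullDim_bIdeal_le' k p 𝔭 hH hP hdim).le)

end HironakaOnly

/-- **The named fact `Mizutani1973_vectorGroup_of_dim_le`, DISCHARGED MODULO HIRONAKA'S GENERATION THEOREM ALONE**
(`Hironaka1970_thm1_cor`: "`U(𝔭)` is generated by additive forms"; Oda's Prop. 2.2 (ii) is NOT needed, because it holds in
the tree at vector-group points and its `⊆` half always).  The mathematics is `mizutaniLowerBound`.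
[cite: Mizutani1973HironakaGroupSchemes, p. 85 (1), Thm. 2.8] -/
theorem mizutani1973_vectorGroup_of_dim_le_of_hironaka (p : ℕ) [Fact p.Prime] (hH : Hironaka1970_thm1_cor.{u} p) :
    Mizutani1973_vectorGroup_of_dim_le.{u} p := by
  intro k _ _ n 𝔭 hP hdim
  haveI : 𝔭.IsPrime := hP.1
  exact isVectorGroup_of_ringKrullDim_bIdeal_le' k p 𝔭 hH hP hdim

end Summit.ResolutionOfSingularities.KangarooAtlas.Mizutani
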